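import Mathlib
import Literature.Computability.AlgebraicComplexity.ST21FormulaComplexityBounds
import Summits.ValiantsHypothesis.ValiantsHypothesis.Theorems.BarrierLeverSuccinctHittingSetsForVPStubFullSupport
import Summits.ValiantsHypothesis.ValiantsHypothesis.Theorems.BarrierLeverDefinableEquationsSparsityLemmas

/-!
# Crux `BarrierLever.DefinableEquations` (stmt-8745) / `SingleSizeEquations` (stmt-8749) —
# SPARSITY WALL: an equation for size `s` has `≥ 2^{(s - 2n - 1)/(2n+2) + 1}` monomials
# (differential closure, III; val-np-p5 g8)

`I(n, s)` = polynomials in the `N = C(2n,n)` coefficient variables vanishing at `coeff(g)` for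
every `g` of degree `≤ n` and fan-in-two size `≤ s` (so `I(n, n^b)` = equations for
`SmallCircuits ℂ n b`).  THEOREM (`card_support_ge_two_pow`): every nonzero `E ∈ I(n, s)` with
`2n + 1 + r(2n + 2) ≤ s` has at least `2^(r+1)` monomials.  Hence
(`card_support_ge_two_pow_smallCircuits`): equations for `SmallCircuits ℂ n b` — in particular
every Boolean-sum witness of the crux at `(n, b)` — have `≥ 2^{≈ n^{b-1}/2}` monomials:
`≥ 2^{(n-4)/2 + 1}` at the open rung `b = 2` (`rung_two_card_support`; the tree had `≥ 2`,
`two_le_card_support_of_equation_two`, lead c8), and `≥ 2^{n(n-2)/2}` at `b = 3`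
(`rung_three_card_support`) — SUPER-POLYNOMIAL in `N ≤ 4^n`: from `b = 3` on, no equation is a
`poly(N)`-term polynomial, whatever its circuit complexity.

PROOF (one page).  Base (§2): for `s ≥ 2n + 1` the full-support circuit `(1 + Σ x_i)^n` (size
`≤ (n+1) + n` computing the affine form once, `SahaThankey2021.complexity_pow_le`; all
`C(2n,n)` coefficients nonzero, `FullSupport.coeff_linearForm_pow_ne_zero`) is in the class, so
no monomial `a·c^m` is an equation.  Step (§1, §3 and the lemma file `…SparsityLemmas.lean`): a
non-monomial `E` has a coordinate `μ` carrying two different exponents `j_min < j_max = deg_μ E`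
(`exists_splitting_coordinate`); the
TOP piece `∂_μ^{j_max} E` and the BOTTOM piece `(∂_μ^{j_min} E)(c_μ := 0)` are NONZERO
(`top_ne_zero`, `bottom_ne_zero`; characteristic `0`), lie in `I(n, s - (2n+2))` — the top piece
by the differential closure (Part I, `DifferentialClosure.iterate_pderiv_vanishes`), the bottom
piece because `∂_μ^j E` vanishes on the whole LINE `coeff(f) + ℂ e_μ ⊆ Z(E)` and in particular
at its point with `μ`-coordinate `0` (`iterate_pderiv_eval_line_eq_zero` of the lemma file, §1
`killVar_iterate_pderiv_vanishes`) — and their monomials, shifted back by `j_max e_μ` resp.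
`j_min e_μ`, are disjoint subsets of the monomials of `E` (`card_support_pieces_le`).  So
`T(s) ≥ 2 T(s - 2n - 2)`, `T(2n+1) ≥ 2`.

ROUTE-INDEPENDENT (no `Theses` import).  What this is NOT: no verdict on the crux moves (b = 2
OPEN, Chatterjee–Tengse arXiv:2309.07612 §1.3 dir. 2); nothing bears on `VP ≠ VNP`; a Boolean sum
of size `N^a` can of course have `2^{N^a}` monomials — the wall excludes SPARSE witnesses (e.g.
any `q = 0` datum presented as a `poly(N)`-term sum at `b ≥ 3`), not succinct ones.  No
definitions, no named facts; standard axioms.  Refs: Bürgisser 2000 §2.1 (cost model);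
Guo–Kumar–Saptharishi–Solomon 2019 §3 (Taylor coefficients, tree `GKSS2019.*`).
-/

-- `Summit.ValiantsHypothesis.ValiantsHypothesis.…` repeats a component by the D-0017 layout
-- (single-conjunct summit), which the `dupNamespace` linter flags; the name is mandated.
set_option linter.dupNamespace false

noncomputable section

namespace Summit.ValiantsHypothesis.ValiantsHypothesis.Theorems.BarrierLeverDefinableEquations

open MvPolynomial
open Literature.Computability.AlgebraicComplexity Literature.Barriers.ValiantsHypothesis
open Summit.ValiantsHypothesis.ValiantsHypothesis.Theorems.BarrierLever.SuccinctHittingSetsForVP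
  (FullSupport.totalDegree_linearForm_pow_le FullSupport.complexity_linearForm_le
    FullSupport.coeff_linearForm_pow_ne_zero)
open scoped BigOperators

namespace SparsityWall

/-! ## §1 Both pieces of the splitting are equations one rung down -/

/-- The line through `coeff(f)` in the direction `e_μ` lies in the zero set of an equation for
size `s + 2n + 2` whenever `L(f) ≤ s`. [folklore] -/
theorem line_subset_zeros {n s : ℕ} {E : MvPolynomial ↥(degLEMonomials n) ℂ}
    (hE : ∀ g : MvPolynomial (Fin n) ℂ, g.totalDegree ≤ n → complexity g ≤ s + (2 * n + 2) →
      eval (coeffVector (degLEMonomials n) g) E = 0)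
    {f : MvPolynomial (Fin n) ℂ} (hf : f.totalDegree ≤ n) (hL : complexity f ≤ s)
    (μ : ↥(degLEMonomials n)) (t : ℂ) :
    eval (fun ν => coeffVector (degLEMonomials n) f ν + if ν = μ then t else 0) E = 0 := by
  have h := (funext (DifferentialClosure.coeffVector_translate f μ t)).symm
  rw [show (fun ν => coeffVector (degLEMonomials n) f ν + if ν = μ then t else 0) =
      coeffVector (degLEMonomials n) (f + monomial (μ : Fin n →₀ ℕ) t) from h]
  obtain ⟨hdeg, hsize⟩ := DifferentialClosure.translate_mem hf hL μ t
  exact hE _ hdeg hsize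

/-- **Bottom piece.**  If `E` is an equation for size `s + 2n + 2` then `(∂_μ^j E)(c_μ := 0)` is
an equation for size `s` (every order `j`): the derivative vanishes on the whole line
`coeff(f) + ℂ e_μ` (§1), in particular at its point with `μ`-coordinate `0`. [folklore] -/
theorem killVar_iterate_pderiv_vanishes {n s : ℕ} {E : MvPolynomial ↥(degLEMonomials n) ℂ}
    (hE : ∀ g : MvPolynomial (Fin n) ℂ, g.totalDegree ≤ n → complexity g ≤ s + (2 * n + 2) →
      eval (coeffVector (degLEMonomials n) g) E = 0)
    (μ : ↥(degLEMonomials n)) (j : ℕ)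
    (f : MvPolynomial (Fin n) ℂ) (hf : f.totalDegree ≤ n) (hL : complexity f ≤ s) :
    eval (coeffVector (degLEMonomials n) f)
      (aeval (fun ν => if ν = μ then (0 : MvPolynomial ↥(degLEMonomials n) ℂ) else X ν)
        ((pderiv μ)^[j] E)) = 0 := by
  rw [eval_killVar]
  have hpt : (fun ν => if ν = μ then (0 : ℂ) else coeffVector (degLEMonomials n) f ν) =
      fun ν => coeffVector (degLEMonomials n) f ν +
        if ν = μ then -coeffVector (degLEMonomials n) f μ else 0 := by
    funext ν; split_ifs with h
    · subst h; ring
    · ring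
  rw [hpt]
  exact iterate_pderiv_eval_line_eq_zero E _ μ (line_subset_zeros hE hf hL μ) j _

/-! ## §2 The base: no monomial equation once the full-support circuit is in the class -/

/-- `(1 + x₁ + ⋯ + x_n)^n` has degree `≤ n` and size `≤ 2n + 1` (`n + 1` gates for the affine form,
computed ONCE, then `n` product gates: `SahaThankey2021.complexity_pow_le`). [folklore] -/
theorem fullSupport_mem {n : ℕ} :
    ((1 + ∑ i : Fin n, X i : MvPolynomial (Fin n) ℂ) ^ n).totalDegree ≤ n ∧
      complexity ((1 + ∑ i : Fin n, X i : MvPolynomial (Fin n) ℂ) ^ n) ≤ 2 * n + 1 := by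
  refine ⟨FullSupport.totalDegree_linearForm_pow_le n, ?_⟩
  calc complexity ((1 + ∑ i : Fin n, X i : MvPolynomial (Fin n) ℂ) ^ n)
      ≤ complexity (1 + ∑ i : Fin n, X i : MvPolynomial (Fin n) ℂ) + n :=
        SahaThankey2021.complexity_pow_le _ _
    _ ≤ (n + 1) + n := Nat.add_le_add_right FullSupport.complexity_linearForm_le _
    _ = 2 * n + 1 := by ring

/-- **Base of the recursion.**  A nonzero equation for size `s ≥ 2n + 1` has at least two monomials:
a single monomial `a · c^m` does not vanish at the full-support point `coeff((1 + Σ x_i)^n)`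
(`FullSupport.coeff_linearForm_pow_ne_zero`). [folklore] -/
theorem two_le_card_support {n s : ℕ} (hs : 2 * n + 1 ≤ s) {E : MvPolynomial ↥(degLEMonomials n) ℂ}
    (hE0 : E ≠ 0)
    (hE : ∀ g : MvPolynomial (Fin n) ℂ, g.totalDegree ≤ n → complexity g ≤ s →
      eval (coeffVector (degLEMonomials n) g) E = 0) :
    2 ≤ E.support.card := by
  classical
  by_contra hlt
  have hcard : E.support.card = 1 := by
    have := (support_nonempty.mpr hE0).card_pos; omega
  obtain ⟨m, hm⟩ := Finset.card_eq_one.mp hcard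
  have hEm : E = monomial m (coeff m E) := by
    conv_lhs => rw [E.as_sum, hm, Finset.sum_singleton]
  have hcm : coeff m E ≠ 0 := mem_support_iff.mp (hm ▸ Finset.mem_singleton_self m)
  obtain ⟨hdeg, hsize⟩ := @fullSupport_mem n
  have hval := hE _ hdeg (hsize.trans hs)
  rw [hEm, eval_monomial] at hval
  refine mul_ne_zero hcm ?_ hval
  rw [Finsupp.prod]
  refine Finset.prod_ne_zero_iff.mpr fun μ _ => pow_ne_zero _ ?_
  rw [coeffVector_apply]
  exact FullSupport.coeff_linearForm_pow_ne_zero n (μ : Fin n →₀ ℕ) μ.2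

/-! ## §3 The recursion: each rung `2n + 2` of size DOUBLES the number of monomials -/

/-- **Sparsity wall.**  A nonzero polynomial in the `C(2n,n)` coefficient variables vanishing at
`coeff(g)` for every `g` of degree `≤ n` and size `≤ s`, where `2n + 1 + r (2n + 2) ≤ s`, has at
least `2^(r+1)` monomials.  Proof: such an `E` is not a monomial (§5), so some coordinate `μ`
carries two different exponents `j_min < j_max`; the pieces `∂_μ^{j_max} E` and
`(∂_μ^{j_min} E)(c_μ := 0)` are nonzero equations for size `s - (2n+2)` (Part I §2 and §3 here)
with disjointly embedded supports (§4); induct. [folklore] -/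
theorem card_support_ge_two_pow {n : ℕ} (r : ℕ) :
    ∀ {s : ℕ} {E : MvPolynomial ↥(degLEMonomials n) ℂ}, 2 * n + 1 + r * (2 * n + 2) ≤ s → E ≠ 0 →
      (∀ g : MvPolynomial (Fin n) ℂ, g.totalDegree ≤ n → complexity g ≤ s →
        eval (coeffVector (degLEMonomials n) g) E = 0) →
      2 ^ (r + 1) ≤ E.support.card := by
  induction r with
  | zero =>
    intro s E hs hE0 hE
    exact two_le_card_support (by simpa using hs) hE0 hE
  | succ r ih =>
    intro s E hs hE0 hE
    -- one rung below `s`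
    obtain ⟨s', rfl⟩ : ∃ s', s = s' + (2 * n + 2) := ⟨s - (2 * n + 2), by
      have : 2 * n + 2 ≤ s := by nlinarith
      omega⟩
    have hs' : 2 * n + 1 + r * (2 * n + 2) ≤ s' := by nlinarith
    -- `E` is not a monomial: split along a coordinate `μ`
    have h2 : 2 ≤ E.support.card := two_le_card_support (by omega) hE0 hE
    obtain ⟨μ, m₁, hm₁, hmin, hlt⟩ := exists_splitting_coordinate h2
    -- both pieces are nonzero equations for size `s'`
    have htop := ih hs' (top_ne_zero μ hE0)
      (fun g hg hgL => DifferentialClosure.iterate_pderiv_vanishes hE μ _ g hg hgL)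
    have hbot := ih hs' (bottom_ne_zero μ hm₁ hmin)
      (fun g hg hgL => killVar_iterate_pderiv_vanishes hE μ _ g hg hgL)
    have hpieces := card_support_pieces_le μ E hlt
    calc 2 ^ (r + 1 + 1) = 2 ^ (r + 1) + 2 ^ (r + 1) := by ring
      _ ≤ _ := (Nat.add_le_add htop hbot).trans hpieces

/-! ## §4 At the crux: `SmallCircuits ℂ n b` -/

/-- **Sparsity wall for equations of `SmallCircuits ℂ n b`.**  If `2n + 1 + r(2n+2) ≤ n^b` then
every nonzero `E` vanishing on `coeff(SmallCircuits ℂ n b)` — in particular every Boolean-sum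
witness `boolSum H` of `DefinableEquations` / `SingleSizeEquations` at `(n, b)` — has at least
`2^(r+1)` monomials; `r ≈ n^{b-1}/2`, so for `b ≥ 3` the number of monomials exceeds every fixed
power of `N = C(2n,n) ≤ 4^n` eventually (no poly(N)-sparse equations), and at `b = 2` it is
`≥ 2^{n/2 - 1}`. [folklore] -/
theorem card_support_ge_two_pow_smallCircuits {n b r : ℕ} (hr : 2 * n + 1 + r * (2 * n + 2) ≤ n ^ b)
    {E : MvPolynomial ↥(degLEMonomials n) ℂ} (hE0 : E ≠ 0)
    (hE : ∀ f ∈ SmallCircuits ℂ n b, eval (coeffVector (degLEMonomials n) f) E = 0) :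
    2 ^ (r + 1) ≤ E.support.card :=
  card_support_ge_two_pow r hr hE0 fun g hg hgL => hE g ⟨hg, hgL⟩

/-- **The open rung `b = 2`:** for `n ≥ 4`, every nonzero equation for `SmallCircuits ℂ n 2` has at
least `2^((n - 4) / 2 + 1) ≥ 2^{(n-3)/2}` monomials (lead c8's battery had `≥ 2`,
`two_le_card_support_of_equation_two`). [folklore] -/
theorem rung_two_card_support {n : ℕ} (hn : 4 ≤ n) {E : MvPolynomial ↥(degLEMonomials n) ℂ}
    (hE0 : E ≠ 0)
    (hE : ∀ f ∈ SmallCircuits ℂ n 2, eval (coeffVector (degLEMonomials n) f) E = 0) :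
    2 ^ ((n - 4) / 2 + 1) ≤ E.support.card := by
  refine card_support_ge_two_pow_smallCircuits (b := 2) ?_ hE0 hE
  have hk : 2 * ((n - 4) / 2) + 4 ≤ n := by omega
  rw [sq]
  nlinarith [hk, Nat.zero_le ((n - 4) / 2)]

/-- **Rung `b = 3`: super-polynomially many monomials in `N`.**  For `n ≥ 4` every nonzero
equation for `SmallCircuits ℂ n 3` has at least `2^(n(n-2)/2)` monomials (instance
`r + 1 = n(n-2)/2` of the wall: `2n + 1 + (n(n-2)/2) (2n+2) - (2n+2) ≤ n³`), which exceeds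
`C(2n,n)^a ≤ 4^{a n}` as soon as `n(n-2) > 4 a n`. [folklore] -/
theorem rung_three_card_support {n : ℕ} (hn : 4 ≤ n) {E : MvPolynomial ↥(degLEMonomials n) ℂ}
    (hE0 : E ≠ 0)
    (hE : ∀ f ∈ SmallCircuits ℂ n 3, eval (coeffVector (degLEMonomials n) f) E = 0) :
    2 ^ (n * (n - 2) / 2) ≤ E.support.card := by
  have hn2 : 1 ≤ n * (n - 2) / 2 := by
    apply Nat.le_div_iff_mul_le (by norm_num) |>.mpr
    have : 2 ≤ n - 2 := by omega
    nlinarith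
  obtain ⟨r, hr⟩ : ∃ r, n * (n - 2) / 2 = r + 1 := ⟨n * (n - 2) / 2 - 1, by omega⟩
  rw [hr]
  refine card_support_ge_two_pow_smallCircuits (b := 3) ?_ hE0 hE
  have hk : 2 * (r + 1) ≤ n * (n - 2) := by
    have := Nat.div_mul_le_self (n * (n - 2)) 2; omega
  obtain ⟨m, rfl⟩ : ∃ m, n = m + 4 := ⟨n - 4, by omega⟩
  have h1 : (m + 4) * (m + 4 - 2) = (m + 4) * (m + 2) := by congr 1
  rw [h1] at hk
  ring_nf
  ring_nf at hk
  nlinarith [hk, Nat.zero_le r, Nat.zero_le m, Nat.zero_le (r * m)]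

/-! ## §5 Relation to the tree's sparse-hitting theorem (crux `SuccinctHittingSetsForVP` side)
## and the hitting-set form for every size bound

ATTRIBUTION / WHAT IS NEW (appended by the same seat).  The dual statement "equations of
`SmallCircuits ℂ n b` have `≥ 2^(t+1)` monomials when a FULL-SUPPORT `f₀ ∈ SmallCircuits ℂ n b'`
exists and `n^{b'} + t(2n+2) + 1 ≤ n^b`" is ALREADY in the tree on the other crux's side:
`BarrierLever.SuccinctHittingSetsForVP.Sparse.two_pow_le_card_support_of_vanishes` /
`isSuccinctHittingSet_card_support_lt` (Forbes–Shpilka–Volk 2018 Lemma 31–32 / Cor. 34 made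
succinct; proof via the narrow monomial of the full-support SHIFT and Oliveira's product-sparsity
lemma), instantiated there with `f₀ ∈ SmallCircuits ℂ n 3` (`b ≥ 4`: `> 2^{n^{b-3}}` monomials).
The present file differs in (i) the PROOF (differential closure: top/bottom pieces along a
splitting coordinate, no shift, no sparsity-of-products lemma), (ii) the SIZE-PARAMETRISED form
`2n + 1 + r(2n+2) ≤ s` with the full-support circuit at size `2n + 1` (the affine form computed
once), which is what makes the open rung `b = 2` non-trivial (`≥ 2^{(n-4)/2+1}` monomials; the
`n^{b'}`-form needs `b' ≥ 2` and gives nothing at `b = 2`) and gives `2^{n(n-2)/2}` at `b = 3`.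
Below, the same content in FSV's hitting-set language for every size bound. -/

/-- **Hitting-set form, every size bound** (FSV Def. 3): the coefficient vectors of the
`n`-variate polynomials of degree `≤ n` and size `≤ s`, `2n + 1 + r(2n+2) ≤ s`, hit every nonzero
polynomial in the `C(2n,n)` coefficient variables with fewer than `2^(r+1)` monomials — size
LINEAR in `n · log₂(sparsity)`, any degree and any circuit size of the distinguisher.  Compare
`Sparse.isSuccinctHittingSet_card_support_lt` (size `n^{b'} + t(2n+2) + 1`, `b' ≥ 2`).
[cite: ForbesShpilkaVolk2018, Cor. 34] -/
theorem isSuccinctHittingSet_sparse_of_size {n r s : ℕ} (hs : 2 * n + 1 + r * (2 * n + 2) ≤ s) :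
    IsSuccinctHittingSet (degLEMonomials n)
      {f : MvPolynomial (Fin n) ℂ | f.totalDegree ≤ n ∧ complexity f ≤ s}
      {D : MvPolynomial ↥(degLEMonomials n) ℂ | D.support.card < 2 ^ (r + 1)} := by
  intro D hD hD0
  by_contra hcon
  push Not at hcon
  have h := card_support_ge_two_pow r hs hD0 fun g hg hgL => hcon g ⟨hg, hgL⟩
  exact absurd hD (not_lt.mpr h)

/-- **The open rung in hitting form:** for `n ≥ 4`, `SmallCircuits ℂ n 2` is a succinct hitting set
for all nonzero polynomials with fewer than `2^((n-4)/2 + 1)` monomials (the tree's sparse-hitting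
theorems start at the simple class `SmallCircuits ℂ n 3`). [cite: ForbesShpilkaVolk2018, Cor. 34] -/
theorem isSuccinctHittingSet_sparse_rung_two {n : ℕ} (hn : 4 ≤ n) :
    IsSuccinctHittingSet (degLEMonomials n) (SmallCircuits ℂ n 2)
      {D : MvPolynomial ↥(degLEMonomials n) ℂ | D.support.card < 2 ^ ((n - 4) / 2 + 1)} := by
  intro D hD hD0
  by_contra hcon
  push Not at hcon
  exact absurd hD (not_lt.mpr (rung_two_card_support hn hD0 hcon))

end SparsityWall

end Summit.ValiantsHypothesis.ValiantsHypothesis.Theorems.BarrierLeverDefinableEquations
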